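import Summits.NavierStokesRegularity.NavierStokesRegularity.Theorems.TypeIIInviscidRelaxationAxisymSwirlRegularZhangBarrierRiccati
import HarnessLib

/-!
# Toward the κ-inflow barriers, `κ ∈ (0,1]`: the Riccati inequality of the tail in ABSTRACT form

Helper toward the crux `AxisymSwirlRegular` (stmt-NavierStokesRegularity-1964, route TypeIIInviscidRelaxation),
registered line `radial_inflow_split`, criterion side (⟨19059⟩); theorems only.

Context.  The κ-inflow criterion (`RadialInflowComparisonT.hasSmoothExtensionPast_of_kappaEnvelope`, ideator line
`kappa-inflow` of ns-idea-4) is a tree theorem modulo ONE real-analysis statement per `(κ, M)`: a time-dependent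
half-line barrier for the envelope `E(r,t) = M r^{κ−1}(T−t)^{−κ/2}`.  At `κ = 1` the barrier is now explicit
(`…ZhangBarrier*`, giving `Zhang2026_partialTypeI_regularity_holds`).  For `κ ∈ (0,1)` the same self-similar ansatz
`w = Λ(T−t)^m F(r/√(T−t))` leads to the profile inequality `F″ + (Mξ^{κ−1} − 1/ξ − ξ/2)F′ + mF ≤ 0`, and the
`κ = 1` construction deforms: inner layer `u′ = ξ e^{−(M/κ)ξ^κ − ξ}`, outer factor `v = e^{mψ}`,
`ψ′ = φ = A e^{−h} + 2/√(1+D²)` with `h = (M/κ)ξ^κ` and the DEFORMED TAIL VARIABLE `D(ξ) = ξ − 2Mξ^{κ−1}`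
(at `κ = 1`, `D = ξ − 2M`).  In the atoms `ξ, D, D′ = (2−κ) − (1−κ)D/ξ, S = √(1+D²), Q = A e^{−h}` the Riccati
expression `φ′ + (Mξ^{κ−1} − 1/ξ − ξ/2)φ + mφ²` is RATIONAL:
`−Q(1/ξ + ξ/2) − 2DD′/S³ − D/S − 2/(ξS) + m(Q + 2/S)²` (because `Mξ^{κ−1} = (ξ−D)/2` and `h′ = Mξ^{κ−1}`).

THIS FILE proves the resulting inequality `≤ −1` from the structural hypotheses alone (`riccati_abstract`):
`0 < ξ`, `0 < κ ≤ 1`, `D < ξ`, `S² = 1 + D²`, `0 < Q ≤ A`, `16(A+2)m = 1`, and `Q ≥ 32` wherever `D < 1`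
(for the actual functions: `D < 1 ⇒ ξ ≤ 1 + 2M ⇒ h ≤ M(1+2M)/κ`, so `A = 32 e^{M(1+2M)/κ}` works).  On `D ≥ 1`,
`D′ ≥ 1` reduces it VERBATIM to the `κ = 1` tail lemma `ZhangBarrier.tail_region_one`; on `D < 1` the new term
`−2DD′/S³ ≤ 4 + 2/ξ` is paid by `Q/ξ`.  What remains for a κ-barrier file: the calculus instantiation (rpow
derivatives of `h`, `D`; the interval-integral inner layer `u` and `ψ = ∫φ` with the elementary comparison
`∫ 2dη/(η − 2Mη^{κ−1}) = (2/(2−κ)) log(η^{2−κ} − 2M)` for the `ξ^{2m}` bounds) — recipe numerically verified for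
`κ ∈ {1/4,1/2,3/4,0.9}`, `M ∈ {1/2,2,5,20}` (hand 2-g1 census on ⟨1964⟩).

Pure Mathlib real algebra; no NS statement here. [new]
-/

noncomputable section

set_option linter.dupNamespace false

open Set Real

namespace Summit.NavierStokesRegularity.NavierStokesRegularity.Theorems.ZhangBarrier

/-- On `D < 0` (and in fact whenever `D < ξ`), the deformed-tail derivative term is controlled:
`−2 D D′/S³ ≤ 4 + 2/ξ` for `D′ = (2−κ) − (1−κ)D/ξ`, `S = √(1+D²)`, `0 < κ ≤ 1`. [new] -/
theorem tail_deriv_term_le {ξ D D' S κ : ℝ} (hξ : 0 < ξ) (hκ0 : 0 < κ) (hκ1 : κ ≤ 1) (hDξ : D < ξ)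
    (hD' : D' = (2 - κ) - (1 - κ) * D / ξ) (hS : 0 < S) (hSD : S ^ 2 = 1 + D ^ 2) :
    -(2 * D * D') / S ^ 3 ≤ 4 + 2 * ξ⁻¹ := by
  have hS1 : 1 ≤ S := by nlinarith
  have hS3 : 0 < S ^ 3 := by positivity
  rw [div_le_iff₀ hS3]
  rcases le_or_gt 0 D with hD0 | hD0
  · -- `D ≥ 0`: `D′ ≥ 1 > 0`, the term is nonpositive
    have hDξ' : D / ξ ≤ 1 := by rw [div_le_one hξ]; exact hDξ.le
    have hD'1 : 1 ≤ D' := by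
      rw [hD']
      have : (1 - κ) * D / ξ ≤ 1 - κ := by
        rw [mul_div_assoc]
        exact mul_le_of_le_one_right (by linarith) hDξ'
      linarith
    have h1 : 0 ≤ 2 * D * D' := by positivity
    have h2 : 0 ≤ (4 + 2 * ξ⁻¹) * S ^ 3 := by positivity
    linarith
  · -- `D < 0`: `2|D|D′ = 2|D|(2−κ) + 2(1−κ)D²/ξ ≤ 4 S³ + 2 S³/ξ`
    have hDabs : -D ≤ S := by nlinarith
    have hD2 : D ^ 2 ≤ S ^ 2 := by nlinarith
    have hS13 : S ≤ S ^ 3 := by nlinarith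
    have hξinv : 0 < ξ⁻¹ := inv_pos.2 hξ
    have e : -(2 * D * D') = 2 * (-D) * (2 - κ) + 2 * (1 - κ) * D ^ 2 * ξ⁻¹ := by
      rw [hD']; field_simp; ring
    rw [e]
    have t1 : 2 * (-D) * (2 - κ) ≤ 4 * S ^ 3 := by nlinarith
    have t2 : 2 * (1 - κ) * D ^ 2 * ξ⁻¹ ≤ 2 * ξ⁻¹ * S ^ 3 := by
      have : (1 - κ) * D ^ 2 ≤ S ^ 3 := by nlinarith
      nlinarith
    nlinarith

/-- **The Riccati inequality of the κ-family tail, abstract form.** In the atoms `ξ, D, D′, S, Q, A, m`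
(see the module docstring: `D = ξ − 2Mξ^{κ−1}`, `D′ = (2−κ) − (1−κ)D/ξ`, `S = √(1+D²)`, `Q = A e^{−(M/κ)ξ^κ}`):
if `0 < ξ`, `0 < κ ≤ 1`, `D < ξ`, `S² = 1 + D²`, `0 < Q ≤ A`, `16(A+2)m = 1` and `Q ≥ 32` whenever `D < 1`, then
`−Q(1/ξ + ξ/2) − 2DD′/S³ − D/S − 2/(ξS) + m(Q + 2/S)² ≤ −1`.  (`D ≥ 1`: `tail_region_one` with `y = D` after
`D′ ≥ 1`; `D < 1`: `tail_deriv_term_le`, `|D| ≤ S`, `8m ≤ 1/4`, and `32(1/ξ + ξ/2 − 1/8) ≥ 25/4 + 2/ξ`.) [new] -/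
theorem riccati_abstract {ξ D D' S Q A m κ : ℝ} (hξ : 0 < ξ) (hκ0 : 0 < κ) (hκ1 : κ ≤ 1)
    (hDξ : D < ξ) (hD' : D' = (2 - κ) - (1 - κ) * D / ξ) (hS : 0 < S) (hSD : S ^ 2 = 1 + D ^ 2)
    (hQ0 : 0 < Q) (hQA : Q ≤ A) (hm0 : 0 < m) (hmA : 16 * (A + 2) * m = 1)
    (hlow : D < 1 → 32 ≤ Q) :
    -(Q * (ξ⁻¹ + ξ / 2)) - 2 * D * D' / S ^ 3 - D / S - 2 * ξ⁻¹ / S + m * (Q + 2 / S) ^ 2 ≤ -1 := by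
  have hA : 0 < A := hQ0.trans_le hQA
  have hm32 : 32 * m ≤ 1 := by nlinarith
  have hm16 : 16 * m ≤ 1 := by linarith
  have hξinv : 1 ≤ ξ⁻¹ + ξ / 2 := by
    rw [inv_eq_one_div, ← sub_nonneg]
    have : 1 / ξ + ξ / 2 - 1 = ((ξ - 1) ^ 2 + 1) / (2 * ξ) := by field_simp; ring
    rw [this]; positivity
  -- the quadratic term
  have hsq : m * (Q + 2 / S) ^ 2 ≤ 2 * m * Q ^ 2 + 8 * m / S ^ 2 := by
    have h : (Q + 2 / S) ^ 2 ≤ 2 * Q ^ 2 + 2 * (2 / S) ^ 2 := by nlinarith [sq_nonneg (Q - 2 / S)]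
    have := mul_le_mul_of_nonneg_left h hm0.le
    have e : m * (2 * Q ^ 2 + 2 * (2 / S) ^ 2) = 2 * m * Q ^ 2 + 8 * m / S ^ 2 := by field_simp; ring
    linarith
  have hquad : 2 * m * Q ^ 2 ≤ Q / 8 := by
    have h1 : 2 * m * A ≤ 1 / 8 := by nlinarith
    calc 2 * m * Q ^ 2 = (2 * m * Q) * Q := by ring
      _ ≤ (2 * m * A) * Q := by gcongr
      _ ≤ (1 / 8) * Q := by gcongr
      _ = Q / 8 := by ring
  have hcross : 0 ≤ 2 * ξ⁻¹ / S := by positivity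
  rcases le_or_gt 1 D with hD1 | hD1
  · -- region `D ≥ 1`: `D′ ≥ 1`, then the κ = 1 tail lemma with `y = D`
    have hDξ' : D / ξ ≤ 1 := by rw [div_le_one hξ]; exact hDξ.le
    have hD'1 : 1 ≤ D' := by
      rw [hD']
      have : (1 - κ) * D / ξ ≤ 1 - κ := by
        rw [mul_div_assoc]; exact mul_le_of_le_one_right (by linarith) hDξ'
      linarith
    have hderiv : -(2 * D * D') / S ^ 3 ≤ -(2 * D) / S ^ 3 := by
      apply div_le_div_of_nonneg_right _ (by positivity)
      nlinarith
    have htail := tail_region_one hS hSD hD1 hm16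
    have h78 : 0 ≤ ξ⁻¹ + ξ / 2 - 1 / 8 := by linarith
    have h1 := mul_nonneg hQ0.le h78
    have e1 : -(2 * D * D' / S ^ 3) = -(2 * D * D') / S ^ 3 := by ring
    linarith
  · -- region `D < 1`
    have hQ := hlow hD1
    have hderiv := tail_deriv_term_le hξ hκ0 hκ1 hDξ hD' hS hSD
    have hS1 : 1 ≤ S := by nlinarith
    have hDS : -(D / S) ≤ 1 := by
      rw [← neg_div, div_le_iff₀ hS]; nlinarith
    have h8m : 8 * m / S ^ 2 ≤ 1 / 4 := by
      rw [div_le_iff₀ (by positivity)]; nlinarith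
    -- `Q (1/ξ + ξ/2 − 1/8) ≥ 32/ξ + 16 ξ − 4 ≥ 25/4 + 2/ξ`
    have h78 : 7 / 8 ≤ ξ⁻¹ + ξ / 2 - 1 / 8 := by linarith
    have hQb : 32 * (ξ⁻¹ + ξ / 2 - 1 / 8) ≤ Q * (ξ⁻¹ + ξ / 2 - 1 / 8) :=
      mul_le_mul_of_nonneg_right hQ (by linarith)
    have hamgm : 43 ≤ 30 * ξ⁻¹ + 16 * ξ := by
      have hnum : 0 ≤ 16 * ξ ^ 2 - 43 * ξ + 30 := by nlinarith [sq_nonneg (ξ - 43 / 32)]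
      have e : 30 * ξ⁻¹ + 16 * ξ - 43 = (16 * ξ ^ 2 - 43 * ξ + 30) / ξ := by field_simp; ring
      have : 0 ≤ (16 * ξ ^ 2 - 43 * ξ + 30) / ξ := by positivity
      linarith
    have e1 : -(2 * D * D' / S ^ 3) = -(2 * D * D') / S ^ 3 := by ring
    nlinarith

end Summit.NavierStokesRegularity.NavierStokesRegularity.Theorems.ZhangBarrier

end
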